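import Summits.AtomisticToContinuum.Crystallization.Theorems.ExcessDecayLiouvilleDefs
import Summits.AtomisticToContinuum.Crystallization.Theorems.ExcessDecayLiouvilleSiteGeometry

/-!
# Item `ExcessDecay` (stmt-AtomisticToContinuum-9334): reduction to the small-separation, large-ball regime

`ExcessDecay ↔ (PhononStability → ∀ δ > 0, ExcessDecayCore δ)` (`excessDecay_iff`).  This file disposes of
the two trivial regimes of the item:

* `excessDecayCore_of_lt` — for separations `δ > 199/200` the statement is VACUOUS, hence true
  unconditionally: with `ε₀ ≤ (δ − 199/200)/4` and `r₀ = 11/5`, a `δ`-separated `X` cannot be within `ε`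
  of both of two adjacent sites of the ball (`sep_le_of_matched`), so no `X` satisfies the matching
  hypothesis;
* `excessDecayCore_of_reducedAt` — if the conclusion is known in the regime `C/r² < ε/2` (with
  `C ≥ 0`: `ExcessDecayReducedAt δ`), it holds everywhere: when `ε/2 ≤ C/r²` the uncorrected datum
  `(t', A') = (t, A)` is already `(ε/2 + C/r²)`-matched on the smaller ball (`Near₀.mono`);

and records the reduction
`excessDecay_of_reduced : (PhononStability → ∀ δ, 0 < δ → δ ≤ 1 → ExcessDecayReducedAt δ) → ExcessDecay`.
What remains (`ExcessDecayReducedAt δ` for δ ≤ 1: ε ∈ (2C/r², ε₀], r ≥ r₀ unbounded) is the genuine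
Allard/Campanato excess-decay estimate for finite Lennard-Jones equilibria near an admissible affine hcp
two-lattice (harmonic approximation + interior estimates for the force-constant operator + nonlinear and
exterior remainders); it is NOT proved here.  All `[folklore]`.
-/

noncomputable section

namespace Summit.AtomisticToContinuum.Crystallization.Theorems.ExcessDecayLiouville

open scoped BigOperators Topology InnerProductSpace
open Literature.MathematicalPhysics.StatisticalMechanics
open Summit.AtomisticToContinuum.Crystallization.Theses.ExcessDecayLiouville
open Summit.AtomisticToContinuum.Crystallization.Theorems.PhononStabilityNegative

/-- **Large separations are vacuous.**  For `δ > 199/200` the excess-decay statement `ExcessDecayCore δ`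
holds because its hypotheses cannot be met: take `ε₀ = min (1/5) ((δ − 199/200)/4)`, `θ = 1/2`,
`r₀ = 11/5`, `C = 0`; a ball of radius `≥ 11/5` contains two sites of sublattice `0` at distance
`≤ 199/200`, whose `ε`-close points of `X` would be distinct and `< δ` apart. [folklore] -/
theorem excessDecayCore_of_lt {δ : ℝ} (hδ : 199 / 200 < δ) : ExcessDecayCore δ := by
  refine ⟨min (1 / 5) ((δ - 199 / 200) / 4), 1 / 2, 11 / 5, 0, ?_, by norm_num, by norm_num, ?_⟩
  · exact lt_min (by norm_num) (by linarith)
  intro X _ hsep _ c t A r ε hA _ hr _ hε hnear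
  exfalso
  have hε5 : ε ≤ 1 / 5 := hε.trans (min_le_left _ _)
  have hεδ : ε ≤ (δ - 199 / 200) / 4 := hε.trans (min_le_right _ _)
  have h := sep_le_of_matched hA hsep (fun z hz hzc => hnear.2 0 z hz hzc) (by linarith) hr
  linarith

/-- **The trivial regime.**  If the reduced form holds at `δ` (conclusion known whenever `C/r² < ε/2`,
constant `C ≥ 0`), then `ExcessDecayCore δ` holds — in the complementary regime `ε/2 ≤ C/r²` the
hypothesis `Near₀ X c r t A ε` itself gives `Near₀ X c (θr) t A (ε/2 + C/r²)` and `‖A − A‖ = 0 ≤ Cε/r`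
(we enlarge `r₀` to `max r₀ 1` so that `r > 0`). [folklore] -/
theorem excessDecayCore_of_reducedAt {δ : ℝ} (h : ExcessDecayReducedAt δ) : ExcessDecayCore δ := by
  obtain ⟨ε₀, θ, r₀, C, hε₀, hθ, hθ1, hC, h⟩ := h
  refine ⟨ε₀, θ, max r₀ 1, C, hε₀, hθ, hθ1, ?_⟩
  intro X hX hsep hequil c t A r ε hA hI hr hε hεε₀ hnear
  have hr₀ : r₀ ≤ r := (le_max_left _ _).trans hr
  have hr1 : 1 ≤ r := (le_max_right _ _).trans hr
  by_cases hreg : C / r ^ 2 < ε / 2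
  · exact h X hX hsep hequil c t A r ε hA hI hr₀ hε hεε₀ hreg hnear
  · have hreg' : ε / 2 ≤ C / r ^ 2 := not_lt.1 hreg
    refine ⟨t, A, ?_, ?_⟩
    · rw [sub_self, norm_zero]; positivity
    · refine hnear.mono ?_ (by linarith)
      nlinarith

/-- **Reduction of the item.**  `ExcessDecay` follows from its reduced form `ExcessDecayReducedAt δ` for
the separations `0 < δ ≤ 1` under the same harmonic-stability hypothesis: separations `δ > 1` are
vacuous (`excessDecayCore_of_lt`) and the regime `ε/2 ≤ C/r²` is trivial (`excessDecayCore_of_reducedAt`).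
[folklore] -/
theorem excessDecay_of_reduced
    (h : PhononStability → ∀ δ : ℝ, 0 < δ → δ ≤ 1 → ExcessDecayReducedAt δ) : ExcessDecay := by
  rw [excessDecay_iff]
  intro hPS δ hδ
  by_cases hδ1 : δ ≤ 1
  · exact excessDecayCore_of_reducedAt (h hPS δ hδ hδ1)
  · exact excessDecayCore_of_lt (by linarith [lt_of_not_ge hδ1])

end Summit.AtomisticToContinuum.Crystallization.Theorems.ExcessDecayLiouville

end
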